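import Literature.Topology.FourManifolds.LickorishTwistProfile
import Literature.Topology.FourManifolds.CollarExtension
import Literature.Topology.FourManifolds.SmoothEmbeddingCriteria
import HarnessLib

/-!
# Spreading a Dehn twist over a collar, around a core circle (Lickorish 1962, Fig. 11)

Topic `Literature/Topology/FourManifolds`; second file of the proof of leaf **F4** of the
Lickorish–Wallace DAG (see `LickorishTwistProfile.lean`). Given a collared manifold `M`
(`b : BoundaryData I M I₀`, `c : b.Collar`) and an annulus chart `e : 𝕊 1 × ℝ ↪ ∂M` of a Dehn twist
(`Literature.Topology.FourManifolds.AnnulusChart`, the datum of `IsDehnTwist`), we construct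
**Lickorish's twist spread over the collar**: the self-bijection `Ψ` of `M` which at collar height `s`
applies the level twist `twistLevel (s/(2d))` of `LickorishTwistProfile.lean` inside the annulus
(`c ∘ slabSlide ∘ c⁻¹` on the collar, the identity elsewhere; the pattern of
`BoundaryData.Collar.slideExtension` of `CollarExtension.lean`). It restricts on `∂M` to the
*inverse* Dehn twist (`twistExtensionFun_incl`, `twistAt_of_le`), its inverse `Ψ⁻¹` to the Dehn
twist (`twistExtensionInv_incl`), it is the identity above height `3d/2` and off the annulus slab,
level-preserving, and `C^∞` with `C^∞` inverse **off the core circle**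
`c (e (𝕊 1 × {1/2}) × {d})` (`twistExtension : OpenPartialHomeomorph M M`, source and target the
complement of the core circle) — the circle along which `LickorishTwistSurgery.lean` performs the
surgery. Smoothness is proved by descent along the collar
(`contMDiffAt_of_comp_isImmersionAt_of_nhds`) and along the annulus chart (inverses of smooth
embeddings are smooth on their ranges, `contMDiffOn_leftInverse_of_isImmersion`, general models).
Everything here is proved; models `I`, `I₀` are general.

* `AnnulusChart I₀ X`, `AnnulusChart.inv`, `isDehnTwist_iff_annulusChart`;
* `AnnulusChart.twistAt s` / `untwistAt s` (the twists of the surface at profile depth `s`),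
  `contMDiffOn_twistAt` (jointly `C^∞` off the core set);
* `AnnulusChart.slabSlide d` / `slabUnslide d` (the cylinder `X × [0, 1]`, core at height `d`);
* `BoundaryData.Collar.twistExtensionFun/Inv`, `twistCore`, `twistExtension` (`0 < d ≤ 1/3`).

## References

* W. B. R. Lickorish, Ann. of Math. 76 (1962), proof of Thm. 2, p. 539 ("the hole being inside a
  collar `I × X₁`"), Fig. 11. [LickorishAnnals1962]
* M. W. Hirsch, *Differential Topology* (1976), Ch. 8 §2 (spreading an isotopy over a collar).
-/

open scoped Manifold ContDiff Topology
open Set Function Metric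

noncomputable section

namespace Literature.Topology.FourManifolds

universe u

/-- Local notation: `𝔼 n` is the model Euclidean space `EuclideanSpace ℝ (Fin n)`. -/
local notation "𝔼 " n:arg => EuclideanSpace ℝ (Fin n)

/-- Local notation: `𝕊 n` is the unit sphere in `EuclideanSpace ℝ (Fin (n + 1))`. -/
local notation "𝕊 " n:arg => (Metric.sphere (0 : EuclideanSpace ℝ (Fin (n + 1))) 1)

/-! ### Annulus charts -/

namespace LickorishTwist

section Annulus

variable {E₀ H₀ : Type*} [NormedAddCommGroup E₀] [NormedSpace ℝ E₀] [TopologicalSpace H₀]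
  (I₀ : ModelWithCorners ℝ E₀ H₀) (X : Type*) [TopologicalSpace X] [ChartedSpace H₀ X]

/-- An **annulus chart** of a manifold `X` (a surface in every application): a `C^∞` embedding of
the open annulus `𝕊 1 × ℝ` onto an open subset of `X` — the datum `e` of a Dehn twist
`Literature.Topology.FourManifolds.IsDehnTwist` (an open annulus neighbourhood of the simple closed
curve `e (𝕊 1 × {1/2})`; Lickorish, Ann. of Math. 76 (1962), p. 532). [cite: LickorishAnnals1962, p. 532] -/
structure AnnulusChart where
  /-- The embedding `𝕊 1 × ℝ → X`. -/
  toFun : (𝕊 1) × ℝ → X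
  /-- The map is a `C^∞` embedding. -/
  isSmoothEmbedding : Manifold.IsSmoothEmbedding ((𝓡 1).prod 𝓘(ℝ, ℝ)) I₀ ∞ toFun
  /-- The image is open. -/
  isOpen_range : IsOpen (Set.range toFun)

variable {I₀ X}

namespace AnnulusChart

/-- An annulus chart is used as a function `𝕊 1 × ℝ → X`. [folklore] -/
instance : CoeFun (AnnulusChart I₀ X) (fun _ ↦ (𝕊 1) × ℝ → X) := ⟨toFun⟩

variable (e : AnnulusChart I₀ X)

/-- An annulus chart is injective. [folklore] -/
protected theorem injective : Injective e := e.isSmoothEmbedding.isEmbedding.injective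

/-- An annulus chart is continuous. [folklore] -/
protected theorem continuous : Continuous e := e.isSmoothEmbedding.isEmbedding.continuous

/-- An annulus chart is smooth. [folklore] -/
protected theorem contMDiff : ContMDiff ((𝓡 1).prod 𝓘(ℝ, ℝ)) I₀ ∞ e := e.isSmoothEmbedding.contMDiff

/-- An annulus chart is an open embedding. [folklore] -/
protected theorem isOpenEmbedding : Topology.IsOpenEmbedding e :=
  ⟨e.isSmoothEmbedding.isEmbedding, e.isOpen_range⟩

open Classical in
/-- A left inverse `X → 𝕊 1 × ℝ` of the annulus chart (junk off the range). [folklore] -/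
def inv (x : X) : (𝕊 1) × ℝ := if h : x ∈ range e then Classical.choose h else (spherePt 1, 0)

/-- `e.inv` is a left inverse of `e`. [folklore] -/
@[simp] theorem inv_apply (a : (𝕊 1) × ℝ) : e.inv (e a) = a := by
  have h : e a ∈ range e := mem_range_self a
  rw [inv, dif_pos h]
  exact e.injective (Classical.choose_spec h)

/-- On the range, `e ∘ e.inv = id`. [folklore] -/
theorem apply_inv {x : X} (hx : x ∈ range e) : e (e.inv x) = x := by
  obtain ⟨a, rfl⟩ := hx; rw [inv_apply]

/-- **The inverse of an annulus chart is smooth on its range** (a left inverse of an injective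
immersion which is an embedding; general models). [folklore] -/
theorem contMDiffOn_inv : ContMDiffOn I₀ ((𝓡 1).prod 𝓘(ℝ, ℝ)) ∞ e.inv (range e) :=
  contMDiffOn_leftInverse_of_isImmersion e.isSmoothEmbedding.isImmersion
    e.isSmoothEmbedding.isEmbedding e.inv_apply

/-- The unpacked form of a Dehn twist: `IsDehnTwist I φ` iff `φ` is the model twist in some annulus
chart and the identity off it. [folklore] -/
theorem _root_.Literature.Topology.FourManifolds.LickorishTwist.isDehnTwist_iff_annulusChart (φ : X ≃ₘ⟮I₀, I₀⟯ X) :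
    IsDehnTwist I₀ φ ↔ ∃ e : AnnulusChart I₀ X,
      (∀ p, φ (e p) = e (dehnTwistModel p)) ∧ ∀ x, x ∉ range e → φ x = x := by
  constructor
  · rintro ⟨f, hf, ho, h1, h2⟩
    exact ⟨⟨f, hf, ho⟩, h1, h2⟩
  · rintro ⟨e, h1, h2⟩
    exact ⟨e, e.isSmoothEmbedding, e.isOpen_range, h1, h2⟩

/-! #### The twists of `X` supported in the annulus -/

open Classical in
/-- **The twist of `X` at depth `s`**: `e ∘ twistLevel s ∘ e⁻¹` on the annulus, the identity off
it (`twistLevel s` being the identity off `𝕊 1 × (0, 1)`, this is a bijection of `X`). [folklore] -/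
def twistAt (s : ℝ) (x : X) : X := if x ∈ range e then e (twistLevel s (e.inv x)) else x

open Classical in
/-- **The inverse twist of `X` at depth `s`**: `e ∘ untwistLevel s ∘ e⁻¹` on the annulus, the
identity off it. [folklore] -/
def untwistAt (s : ℝ) (x : X) : X := if x ∈ range e then e (untwistLevel s (e.inv x)) else x

/-- On the annulus the twist is `e ∘ twistLevel s ∘ e⁻¹`. [folklore] -/
@[simp] theorem twistAt_apply (s : ℝ) (a : (𝕊 1) × ℝ) : e.twistAt s (e a) = e (twistLevel s a) := by
  rw [twistAt, if_pos (mem_range_self a), inv_apply]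

/-- On the annulus the inverse twist is `e ∘ untwistLevel s ∘ e⁻¹`. [folklore] -/
@[simp] theorem untwistAt_apply (s : ℝ) (a : (𝕊 1) × ℝ) :
    e.untwistAt s (e a) = e (untwistLevel s a) := by
  rw [untwistAt, if_pos (mem_range_self a), inv_apply]

/-- Off the annulus the twist is the identity. [folklore] -/
theorem twistAt_of_not_mem (s : ℝ) {x : X} (hx : x ∉ range e) : e.twistAt s x = x := by
  rw [twistAt, if_neg hx]

/-- Off the annulus the inverse twist is the identity. [folklore] -/
theorem untwistAt_of_not_mem (s : ℝ) {x : X} (hx : x ∉ range e) : e.untwistAt s x = x := by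
  rw [untwistAt, if_neg hx]

/-- The inverse twist is a left inverse of the twist. [folklore] -/
@[simp] theorem untwistAt_twistAt (s : ℝ) (x : X) : e.untwistAt s (e.twistAt s x) = x := by
  by_cases hx : x ∈ range e
  · obtain ⟨a, rfl⟩ := hx
    rw [twistAt_apply, untwistAt_apply, untwistLevel_twistLevel]
  · rw [twistAt_of_not_mem _ _ hx, untwistAt_of_not_mem _ _ hx]

/-- The inverse twist is a right inverse of the twist. [folklore] -/
@[simp] theorem twistAt_untwistAt (s : ℝ) (x : X) : e.twistAt s (e.untwistAt s x) = x := by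
  by_cases hx : x ∈ range e
  · obtain ⟨a, rfl⟩ := hx
    rw [untwistAt_apply, twistAt_apply, twistLevel_untwistLevel]
  · rw [untwistAt_of_not_mem _ _ hx, twistAt_of_not_mem _ _ hx]

/-- At depths `s ≥ 3/4` the twist is the identity. [folklore] -/
theorem twistAt_of_ge {s : ℝ} (hs : 3 / 4 ≤ s) (x : X) : e.twistAt s x = x := by
  by_cases hx : x ∈ range e
  · obtain ⟨a, rfl⟩ := hx
    rw [twistAt_apply, twistLevel_eq_self (Or.inr (Or.inr hs))]
  · exact twistAt_of_not_mem _ _ hx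

/-- At depths `s ≥ 3/4` the inverse twist is the identity. [folklore] -/
theorem untwistAt_of_ge {s : ℝ} (hs : 3 / 4 ≤ s) (x : X) : e.untwistAt s x = x := by
  by_cases hx : x ∈ range e
  · obtain ⟨a, rfl⟩ := hx
    rw [untwistAt_apply, untwistLevel_eq_self (Or.inr (Or.inr hs))]
  · exact untwistAt_of_not_mem _ _ hx

/-- The compact sub-annulus `e (𝕊 1 × [0, 1])` supporting the twists. [folklore] -/
def support : Set X := e '' (univ ×ˢ Icc (0 : ℝ) 1)

/-- The supporting sub-annulus is compact. [folklore] -/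
theorem isCompact_support : IsCompact e.support :=
  (isCompact_univ.prod isCompact_Icc).image e.continuous

/-- Off the supporting sub-annulus the twist is the identity (at every depth). [folklore] -/
theorem twistAt_of_not_mem_support (s : ℝ) {x : X} (hx : x ∉ e.support) : e.twistAt s x = x := by
  by_cases hx' : x ∈ range e
  · obtain ⟨⟨u, r⟩, rfl⟩ := hx'
    have hr : r ≤ 0 ∨ 1 ≤ r := by
      by_contra h
      push Not at h
      exact hx ⟨(u, r), ⟨mem_univ _, h.1.le, h.2.le⟩, rfl⟩
    rw [twistAt_apply, twistLevel_eq_self (a := (u, r)) (by rcases hr with hr | hr <;> simp [hr])]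
  · exact twistAt_of_not_mem _ _ hx'

/-- Off the supporting sub-annulus the inverse twist is the identity. [folklore] -/
theorem untwistAt_of_not_mem_support (s : ℝ) {x : X} (hx : x ∉ e.support) : e.untwistAt s x = x := by
  by_cases hx' : x ∈ range e
  · obtain ⟨⟨u, r⟩, rfl⟩ := hx'
    have hr : r ≤ 0 ∨ 1 ≤ r := by
      by_contra h
      push Not at h
      exact hx ⟨(u, r), ⟨mem_univ _, h.1.le, h.2.le⟩, rfl⟩
    rw [untwistAt_apply, untwistLevel_eq_self (a := (u, r)) (by rcases hr with hr | hr <;> simp [hr])]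
  · exact untwistAt_of_not_mem _ _ hx'

/-- **At depths `s ≤ 1/8` the twist is the inverse Dehn twist**: if `φ` is the model twist in the
chart `e` and the identity off it, then `twistAt e s = φ⁻¹`. [folklore] -/
theorem twistAt_of_le {φ : X ≃ₘ⟮I₀, I₀⟯ X} (h1 : ∀ p, φ (e p) = e (dehnTwistModel p))
    (h2 : ∀ x, x ∉ range e → φ x = x) {s : ℝ} (hs : s ≤ 1 / 8) (x : X) :
    e.twistAt s x = φ.symm x := by
  have key : φ (e.twistAt s x) = x := by
    by_cases hx : x ∈ range e
    · obtain ⟨a, rfl⟩ := hx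
      rw [twistAt_apply, twistLevel_of_le hs, h1, dehnTwistModel_dehnTwistModelInv]
    · rw [twistAt_of_not_mem _ _ hx, h2 x hx]
  calc e.twistAt s x = φ.symm (φ (e.twistAt s x)) := (φ.symm_apply_apply _).symm
    _ = φ.symm x := by rw [key]

/-- **At depths `s ≤ 1/8` the inverse twist is the Dehn twist** `φ`. [folklore] -/
theorem untwistAt_of_le {φ : X ≃ₘ⟮I₀, I₀⟯ X} (h1 : ∀ p, φ (e p) = e (dehnTwistModel p))
    (h2 : ∀ x, x ∉ range e → φ x = x) {s : ℝ} (hs : s ≤ 1 / 8) (x : X) :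
    e.untwistAt s x = φ x := by
  by_cases hx : x ∈ range e
  · obtain ⟨a, rfl⟩ := hx
    rw [untwistAt_apply, untwistLevel_of_le hs, h1]
  · rw [untwistAt_of_not_mem _ _ hx, h2 x hx]

/-- The **core set** `{(e (u, 1/2), 1/2)}` of `X × ℝ` (annulus core at the depth of the puncture),
off which the twists are jointly smooth. [folklore] -/
def coreSet : Set (X × ℝ) := range fun u : 𝕊 1 ↦ (e (u, 1 / 2), (1 / 2 : ℝ))

/-- A point `(e a, s)` lies in the core set iff `(a.2, s)` is the puncture. [folklore] -/
theorem mk_apply_mem_coreSet_iff (a : (𝕊 1) × ℝ) (s : ℝ) :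
    (e a, s) ∈ e.coreSet ↔ (a.2, s) = punct := by
  constructor
  · rintro ⟨u, hu⟩
    simp only [Prod.mk.injEq] at hu
    obtain ⟨h1, h2⟩ := hu
    have := e.injective h1
    rw [← this, ← h2]; rfl
  · intro h
    have h1 : a.2 = 1 / 2 := congrArg Prod.fst h
    have h2 : s = 1 / 2 := congrArg Prod.snd h
    refine ⟨a.1, ?_⟩
    rw [h2, ← h1]

/-- A point of the core set lies over the range of the chart. [folklore] -/
theorem fst_mem_range_of_mem_coreSet {p : X × ℝ} (hp : p ∈ e.coreSet) : p.1 ∈ range e := by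
  obtain ⟨u, rfl⟩ := hp; exact mem_range_self _

variable [T2Space X]

/-- The supporting sub-annulus is closed (`X` Hausdorff). [folklore] -/
theorem isClosed_support : IsClosed e.support := e.isCompact_support.isClosed


/-- The core set is closed (`X` Hausdorff). [folklore] -/
theorem isClosed_coreSet : IsClosed e.coreSet := by
  have : e.coreSet = range (fun u : 𝕊 1 ↦ (e (u, 1 / 2), (1 / 2 : ℝ))) := rfl
  rw [this]
  exact (isCompact_range (by have := e.continuous; fun_prop)).isClosed

/-- The set of points `((u, r), s)` of `(𝕊 1 × ℝ) × ℝ` off the puncture circle is open. [folklore] -/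
theorem _root_.Literature.Topology.FourManifolds.LickorishTwist.isOpen_ne_punct :
    IsOpen {p : ((𝕊 1) × ℝ) × ℝ | (p.1.2, p.2) ≠ punct} :=
  isOpen_ne_fun (by fun_prop) continuous_const

open Classical in
/-- Conjugating a self-map `T` of the annulus by the chart: `e ∘ T ∘ e⁻¹` on the annulus, the
identity off it (the common shape of `twistAt` and `untwistAt`). [folklore] -/
def conjMap (T : (𝕊 1) × ℝ → (𝕊 1) × ℝ) (x : X) : X := if x ∈ range e then e (T (e.inv x)) else x

omit [T2Space X] in
/-- `twistAt s` is the conjugate `e ∘ twistLevel s ∘ e⁻¹` extended by the identity. [folklore] -/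
theorem twistAt_eq_conjMap (s : ℝ) : e.twistAt s = e.conjMap (twistLevel s) := rfl

omit [T2Space X] in
/-- `untwistAt s` is the conjugate `e ∘ untwistLevel s ∘ e⁻¹` extended by the identity. [folklore] -/
theorem untwistAt_eq_conjMap (s : ℝ) : e.untwistAt s = e.conjMap (untwistLevel s) := rfl

omit [T2Space X] in
/-- **Smoothness of a conjugated family at a point over the annulus.** If the family
`(a, s) ↦ T s a` is `C^∞` at `(e⁻¹ x, s)` then `(x, s) ↦ conjMap e (T s) x` is `C^∞` at `(x, s)`
for `x` in the (open) range of the chart. [folklore] -/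
theorem contMDiffAt_conjMap_of_mem {T : ℝ → (𝕊 1) × ℝ → (𝕊 1) × ℝ} {x : X} {s : ℝ}
    (hx : x ∈ range e)
    (hT : ContMDiffAt (((𝓡 1).prod 𝓘(ℝ, ℝ)).prod 𝓘(ℝ, ℝ)) ((𝓡 1).prod 𝓘(ℝ, ℝ)) ∞
      (fun p : ((𝕊 1) × ℝ) × ℝ ↦ T p.2 p.1) (e.inv x, s)) :
    ContMDiffAt (I₀.prod 𝓘(ℝ, ℝ)) I₀ ∞ (fun p : X × ℝ ↦ e.conjMap (T p.2) p.1) (x, s) := by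
  have hopen : IsOpen ((range e) ×ˢ (univ : Set ℝ)) := e.isOpen_range.prod isOpen_univ
  have hG : ContMDiffAt (I₀.prod 𝓘(ℝ, ℝ)) (((𝓡 1).prod 𝓘(ℝ, ℝ)).prod 𝓘(ℝ, ℝ)) ∞
      (fun p : X × ℝ ↦ (e.inv p.1, p.2)) (x, s) :=
    ((e.contMDiffOn_inv.contMDiffAt (e.isOpen_range.mem_nhds hx)).comp (x, s) contMDiffAt_fst).prodMk
      contMDiffAt_snd
  have hF : ContMDiffAt (I₀.prod 𝓘(ℝ, ℝ)) I₀ ∞ (fun p : X × ℝ ↦ e (T p.2 (e.inv p.1))) (x, s) :=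
    e.contMDiff.contMDiffAt.comp (x, s) (hT.comp (x, s) hG)
  refine hF.congr_of_eventuallyEq (Filter.eventuallyEq_of_mem (hopen.mem_nhds ⟨hx, mem_univ _⟩) ?_)
  rintro ⟨y, t⟩ ⟨hy, -⟩
  simp only [conjMap, if_pos hy]

/-- **Smoothness of a conjugated family at a point off the supporting sub-annulus**, provided the
family is the identity off `𝕊 1 × (0, 1)`. [folklore] -/
theorem contMDiffAt_conjMap_of_not_mem {T : ℝ → (𝕊 1) × ℝ → (𝕊 1) × ℝ}
    (hT : ∀ s (a : (𝕊 1) × ℝ), a.2 ≤ 0 ∨ 1 ≤ a.2 → T s a = a) {x : X} (hx : x ∉ e.support) (s : ℝ) :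
    ContMDiffAt (I₀.prod 𝓘(ℝ, ℝ)) I₀ ∞ (fun p : X × ℝ ↦ e.conjMap (T p.2) p.1) (x, s) := by
  have hopen : IsOpen (e.supportᶜ ×ˢ (univ : Set ℝ)) := e.isClosed_support.isOpen_compl.prod isOpen_univ
  refine contMDiffAt_fst.congr_of_eventuallyEq (Filter.eventuallyEq_of_mem (hopen.mem_nhds ⟨hx, mem_univ _⟩) ?_)
  rintro ⟨y, t⟩ ⟨hy, -⟩
  simp only
  by_cases hy' : y ∈ range e
  · obtain ⟨⟨u, r⟩, rfl⟩ := hy'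
    have hr : r ≤ 0 ∨ 1 ≤ r := by
      by_contra h
      push Not at h
      exact hy ⟨(u, r), ⟨mem_univ _, h.1.le, h.2.le⟩, rfl⟩
    rw [conjMap, if_pos (mem_range_self _), inv_apply, hT t (u, r) hr]
  · rw [conjMap, if_neg hy']

/-- **Joint smoothness of the twists** `(x, s) ↦ twistAt e s x` off the core set. [folklore] -/
theorem contMDiffOn_twistAt : ContMDiffOn (I₀.prod 𝓘(ℝ, ℝ)) I₀ ∞
    (fun p : X × ℝ ↦ e.twistAt p.2 p.1) e.coreSetᶜ := by
  rintro ⟨x, s⟩ hp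
  apply ContMDiffAt.contMDiffWithinAt
  simp only [twistAt_eq_conjMap]
  by_cases hx : x ∈ range e
  · refine e.contMDiffAt_conjMap_of_mem hx (contMDiffOn_twistLevel.contMDiffAt (isOpen_ne_punct.mem_nhds ?_))
    intro h
    apply hp
    have := (e.mk_apply_mem_coreSet_iff (e.inv x) s).2 h
    rwa [e.apply_inv hx] at this
  · exact e.contMDiffAt_conjMap_of_not_mem (T := twistLevel)
      (fun s a ha ↦ twistLevel_eq_self (ha.elim Or.inl fun h ↦ Or.inr (Or.inl h)))
      (fun h ↦ hx (image_subset_range _ _ h)) s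

/-- **Joint smoothness of the inverse twists** `(x, s) ↦ untwistAt e s x` off the core set. [folklore] -/
theorem contMDiffOn_untwistAt : ContMDiffOn (I₀.prod 𝓘(ℝ, ℝ)) I₀ ∞
    (fun p : X × ℝ ↦ e.untwistAt p.2 p.1) e.coreSetᶜ := by
  rintro ⟨x, s⟩ hp
  apply ContMDiffAt.contMDiffWithinAt
  simp only [untwistAt_eq_conjMap]
  by_cases hx : x ∈ range e
  · refine e.contMDiffAt_conjMap_of_mem hx (contMDiffOn_untwistLevel.contMDiffAt (isOpen_ne_punct.mem_nhds ?_))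
    intro h
    apply hp
    have := (e.mk_apply_mem_coreSet_iff (e.inv x) s).2 h
    rwa [e.apply_inv hx] at this
  · exact e.contMDiffAt_conjMap_of_not_mem (T := untwistLevel)
      (fun s a ha ↦ untwistLevel_eq_self (ha.elim Or.inl fun h ↦ Or.inr (Or.inl h)))
      (fun h ↦ hx (image_subset_range _ _ h)) s

end AnnulusChart

end Annulus

/-! ### The slide of the cylinder `X × [0, 1]` at depth `d` -/

section Slab

variable {E₀ H₀ : Type*} [NormedAddCommGroup E₀] [NormedSpace ℝ E₀] [TopologicalSpace H₀]
  {I₀ : ModelWithCorners ℝ E₀ H₀} {X : Type*} [TopologicalSpace X] [ChartedSpace H₀ X]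

namespace AnnulusChart

variable (e : AnnulusChart I₀ X) (d : ℝ)

/-- **The twisting slide of the cylinder** `X × [0, 1]` with the core at height `d`: at height `s`
apply the twist at profile depth `s / (2d)`, so that the bottom `X × {0}` is moved by the inverse Dehn
twist, the puncture of the profile sits at height `d`, and the slide is the identity above height
`3d/2`. (Lickorish (1962), p. 539: the toral hole is put "inside a collar `I × X₁`".)
[cite: LickorishAnnals1962, proof of Thm. 2 (p. 539)] -/
def slabSlide (q : X × Set.Icc (0 : ℝ) 1) : X × Set.Icc (0 : ℝ) 1 :=
  (e.twistAt ((q.2 : ℝ) / (2 * d)) q.1, q.2)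

/-- The inverse twisting slide of the cylinder. [folklore] -/
def slabUnslide (q : X × Set.Icc (0 : ℝ) 1) : X × Set.Icc (0 : ℝ) 1 :=
  (e.untwistAt ((q.2 : ℝ) / (2 * d)) q.1, q.2)

/-- The slab slide preserves the height coordinate. [folklore] -/
@[simp] theorem slabSlide_snd (q : X × Set.Icc (0 : ℝ) 1) : (e.slabSlide d q).2 = q.2 := rfl
/-- The inverse slab slide preserves the height coordinate. [folklore] -/
@[simp] theorem slabUnslide_snd (q : X × Set.Icc (0 : ℝ) 1) : (e.slabUnslide d q).2 = q.2 := rfl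
/-- The surface coordinate of the slab slide at height `s` is `twistAt (s / (2d))`. [folklore] -/
@[simp] theorem slabSlide_fst (q : X × Set.Icc (0 : ℝ) 1) :
    (e.slabSlide d q).1 = e.twistAt ((q.2 : ℝ) / (2 * d)) q.1 := rfl
/-- The surface coordinate of the inverse slab slide at height `s` is `untwistAt (s / (2d))`. [folklore] -/
@[simp] theorem slabUnslide_fst (q : X × Set.Icc (0 : ℝ) 1) :
    (e.slabUnslide d q).1 = e.untwistAt ((q.2 : ℝ) / (2 * d)) q.1 := rfl

/-- `slabUnslide` is a left inverse of `slabSlide`. [folklore] -/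
@[simp] theorem slabUnslide_slabSlide (q : X × Set.Icc (0 : ℝ) 1) :
    e.slabUnslide d (e.slabSlide d q) = q := by
  ext1 <;> simp

/-- `slabUnslide` is a right inverse of `slabSlide`. [folklore] -/
@[simp] theorem slabSlide_slabUnslide (q : X × Set.Icc (0 : ℝ) 1) :
    e.slabSlide d (e.slabUnslide d q) = q := by
  ext1 <;> simp

variable {d}

/-- Above height `3d/2` the slide is the identity (`0 < d`). [folklore] -/
theorem slabSlide_eq_self (hd : 0 < d) {q : X × Set.Icc (0 : ℝ) 1} (hq : 3 * d / 2 ≤ (q.2 : ℝ)) :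
    e.slabSlide d q = q := by
  ext1
  · rw [slabSlide_fst, twistAt_of_ge]
    rw [le_div_iff₀ (by linarith)]; linarith
  · rfl

/-- Above height `3d/2` the inverse slide is the identity (`0 < d`). [folklore] -/
theorem slabUnslide_eq_self (hd : 0 < d) {q : X × Set.Icc (0 : ℝ) 1} (hq : 3 * d / 2 ≤ (q.2 : ℝ)) :
    e.slabUnslide d q = q := by
  ext1
  · rw [slabUnslide_fst, untwistAt_of_ge]
    rw [le_div_iff₀ (by linarith)]; linarith
  · rfl

variable (d)

/-- On the bottom of the cylinder the slide is the depth-`0` twist. [folklore] -/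
theorem slabSlide_bot (x : X) : e.slabSlide d (x, ⊥) = (e.twistAt 0 x, ⊥) := by
  ext1
  · simp [slabSlide, show ((⊥ : Set.Icc (0 : ℝ) 1) : ℝ) = 0 from rfl]
  · rfl

/-- On the bottom of the cylinder the inverse slide is the depth-`0` inverse twist. [folklore] -/
theorem slabUnslide_bot (x : X) : e.slabUnslide d (x, ⊥) = (e.untwistAt 0 x, ⊥) := by
  ext1
  · simp [slabUnslide, show ((⊥ : Set.Icc (0 : ℝ) 1) : ℝ) = 0 from rfl]
  · rfl

/-- The **core** of the cylinder slide: the points `(e (u, 1/2), d)` (annulus core at height `d`),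
i.e. the preimage of the core set under `(x, s) ↦ (x, s/(2d))`. [folklore] -/
def slabCore : Set (X × Set.Icc (0 : ℝ) 1) := {q | (q.1, (q.2 : ℝ) / (2 * d)) ∈ e.coreSet}

variable {d}

/-- Membership in the core of the cylinder slide (`0 < d`). [folklore] -/
theorem mk_apply_mem_slabCore_iff (hd : 0 < d) (a : (𝕊 1) × ℝ) (s : Set.Icc (0 : ℝ) 1) :
    (e a, s) ∈ e.slabCore d ↔ a.2 = 1 / 2 ∧ (s : ℝ) = d := by
  rw [slabCore, mem_setOf_eq, mk_apply_mem_coreSet_iff, punct, Prod.mk.injEq,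
    div_eq_iff (by linarith), show (1 : ℝ) / 2 * (2 * d) = d by ring]

/-- A point of the core of the slide lies over the range of the chart. [folklore] -/
theorem fst_mem_range_of_mem_slabCore {q : X × Set.Icc (0 : ℝ) 1} (hq : q ∈ e.slabCore d) :
    q.1 ∈ range e :=
  e.fst_mem_range_of_mem_coreSet hq

/-- The clamped height `projIcc 0 1 d` is `d` for `0 ≤ d ≤ 1`. [folklore] -/
theorem _root_.Literature.Topology.FourManifolds.LickorishTwist.coe_projIcc_unit_of_mem (hd0 : 0 ≤ d) (hd1 : d ≤ 1) :
    ((Set.projIcc (0 : ℝ) 1 zero_le_one d : Set.Icc (0 : ℝ) 1) : ℝ) = d := by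
  rw [Set.projIcc_of_mem _ ⟨hd0, hd1⟩]

/-- The profile point of the core `(1/2, d/(2d))` is the puncture. [folklore] -/
theorem _root_.Literature.Topology.FourManifolds.LickorishTwist.mk_half_div_eq_punct (hd : d ≠ 0) :
    ((1 : ℝ) / 2, d / (2 * d)) = punct := by
  rw [punct, Prod.mk.injEq]
  exact ⟨rfl, by field_simp⟩

/-- **The slide on its core**: the core circle at height `d` is rotated within itself (by the junk
value of the profile at the puncture). [folklore] -/
theorem slabSlide_apply_core (hd : 0 < d) (hd1 : d ≤ 1) (u : 𝕊 1) :
    e.slabSlide d (e (u, 1 / 2), Set.projIcc 0 1 zero_le_one d) =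
      (e (circleMul (twistProfile punct) u, 1 / 2), Set.projIcc 0 1 zero_le_one d) := by
  ext1
  · rw [slabSlide_fst, twistAt_apply, coe_projIcc_unit_of_mem hd.le hd1]
    congr 1
    ext1
    · rw [twistLevel_fst, mk_half_div_eq_punct hd.ne']
    · rfl
  · rfl

/-- The inverse slide on its core. [folklore] -/
theorem slabUnslide_apply_core (hd : 0 < d) (hd1 : d ≤ 1) (u : 𝕊 1) :
    e.slabUnslide d (e (u, 1 / 2), Set.projIcc 0 1 zero_le_one d) =
      (e (circleMul (conjCircle (twistProfile punct)) u, 1 / 2), Set.projIcc 0 1 zero_le_one d) := by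
  ext1
  · rw [slabUnslide_fst, untwistAt_apply, coe_projIcc_unit_of_mem hd.le hd1]
    congr 1
    ext1
    · rw [untwistLevel_fst, mk_half_div_eq_punct hd.ne']
    · rfl
  · rfl

variable (d)

variable [T2Space X]

/-- The core of the cylinder slide is closed. [folklore] -/
theorem isClosed_slabCore : IsClosed (e.slabCore d) :=
  e.isClosed_coreSet.preimage (by fun_prop)

/-- **The cylinder slide is smooth off its core** (product model with corners `I₀ × 𝓡∂ 1`). [folklore] -/
theorem contMDiffOn_slabSlide :
    ContMDiffOn (I₀.prod (𝓡∂ 1)) (I₀.prod (𝓡∂ 1)) ∞ (e.slabSlide d) (e.slabCore d)ᶜ := by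
  have h1 : ContMDiff (I₀.prod (𝓡∂ 1)) (I₀.prod 𝓘(ℝ, ℝ)) ∞
      fun q : X × Set.Icc (0 : ℝ) 1 ↦ (q.1, (q.2 : ℝ) / (2 * d)) :=
    contMDiff_fst.prodMk ((contMDiff_subtype_coe_Icc.comp contMDiff_snd).div_const _)
  exact ((e.contMDiffOn_twistAt.comp h1.contMDiffOn fun q hq ↦ hq)).prodMk contMDiff_snd.contMDiffOn

/-- **The inverse cylinder slide is smooth off the core.** [folklore] -/
theorem contMDiffOn_slabUnslide :
    ContMDiffOn (I₀.prod (𝓡∂ 1)) (I₀.prod (𝓡∂ 1)) ∞ (e.slabUnslide d) (e.slabCore d)ᶜ := by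
  have h1 : ContMDiff (I₀.prod (𝓡∂ 1)) (I₀.prod 𝓘(ℝ, ℝ)) ∞
      fun q : X × Set.Icc (0 : ℝ) 1 ↦ (q.1, (q.2 : ℝ) / (2 * d)) :=
    contMDiff_fst.prodMk ((contMDiff_subtype_coe_Icc.comp contMDiff_snd).div_const _)
  exact ((e.contMDiffOn_untwistAt.comp h1.contMDiffOn fun q hq ↦ hq)).prodMk contMDiff_snd.contMDiffOn

end AnnulusChart

end Slab

end LickorishTwist

/-! ### The extension over a collared manifold `M` -/

section Extension

variable {E H E₀ H₀ : Type*} [NormedAddCommGroup E] [NormedSpace ℝ E] [TopologicalSpace H]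
  [NormedAddCommGroup E₀] [NormedSpace ℝ E₀] [TopologicalSpace H₀]
  {I : ModelWithCorners ℝ E H} {M : Type u} [TopologicalSpace M] [ChartedSpace H M]
  {I₀ : ModelWithCorners ℝ E₀ H₀} {b : BoundaryData I M I₀}

namespace BoundaryData.Collar

open LickorishTwist

variable (c : b.Collar) (e : AnnulusChart I₀ b.carrier) (d : ℝ)

open Classical in
/-- **Lickorish's twist spread over the collar**: `c ∘ slabSlide ∘ c⁻¹` on the collar, the identity
elsewhere — a bijection of `M` which is the inverse Dehn twist on `∂M`, the identity outside
`c(∂M × [0, 3d/2])` and off the annulus slab, and smooth off the core circle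
`c (e (𝕊 1 × {1/2}) × {d})` (Lickorish (1962), p. 539; Schultens (2014), proof of Lemma 7.3.4).
[cite: LickorishAnnals1962, proof of Thm. 2 (p. 539, Fig. 11)] -/
def twistExtensionFun (p : M) : M :=
  if h : p ∈ range c then c (e.slabSlide d (Classical.choose h)) else p

open Classical in
/-- The inverse of Lickorish's twist spread over the collar: `c ∘ slabUnslide ∘ c⁻¹` on the collar,
the identity elsewhere. [folklore] -/
def twistExtensionInv (p : M) : M :=
  if h : p ∈ range c then c (e.slabUnslide d (Classical.choose h)) else p

/-- On the collar the extension is `c ∘ slabSlide ∘ c⁻¹`. [folklore] -/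
theorem twistExtensionFun_apply (q : b.carrier × Set.Icc (0 : ℝ) 1) :
    c.twistExtensionFun e d (c q) = c (e.slabSlide d q) := by
  have h : c q ∈ range c := mem_range_self q
  rw [twistExtensionFun, dif_pos h, c.injective (Classical.choose_spec h)]

/-- On the collar the inverse extension is `c ∘ slabUnslide ∘ c⁻¹`. [folklore] -/
theorem twistExtensionInv_apply (q : b.carrier × Set.Icc (0 : ℝ) 1) :
    c.twistExtensionInv e d (c q) = c (e.slabUnslide d q) := by
  have h : c q ∈ range c := mem_range_self q
  rw [twistExtensionInv, dif_pos h, c.injective (Classical.choose_spec h)]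

/-- Off the collar the extension is the identity. [folklore] -/
theorem twistExtensionFun_of_not_mem {p : M} (hp : p ∉ range c) : c.twistExtensionFun e d p = p := by
  rw [twistExtensionFun, dif_neg hp]

/-- Off the collar the inverse extension is the identity. [folklore] -/
theorem twistExtensionInv_of_not_mem {p : M} (hp : p ∉ range c) : c.twistExtensionInv e d p = p := by
  rw [twistExtensionInv, dif_neg hp]

/-- The inverse extension is a left inverse of the extension. [folklore] -/
@[simp] theorem twistExtensionInv_twistExtensionFun (p : M) :
    c.twistExtensionInv e d (c.twistExtensionFun e d p) = p := by
  by_cases hp : p ∈ range c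
  · obtain ⟨q, rfl⟩ := hp
    rw [twistExtensionFun_apply, twistExtensionInv_apply, AnnulusChart.slabUnslide_slabSlide]
  · rw [twistExtensionFun_of_not_mem _ _ _ hp, twistExtensionInv_of_not_mem _ _ _ hp]

/-- The inverse extension is a right inverse of the extension. [folklore] -/
@[simp] theorem twistExtensionFun_twistExtensionInv (p : M) :
    c.twistExtensionFun e d (c.twistExtensionInv e d p) = p := by
  by_cases hp : p ∈ range c
  · obtain ⟨q, rfl⟩ := hp
    rw [twistExtensionInv_apply, twistExtensionFun_apply, AnnulusChart.slabSlide_slabUnslide]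
  · rw [twistExtensionInv_of_not_mem _ _ _ hp, twistExtensionFun_of_not_mem _ _ _ hp]

/-- The extension is injective. [folklore] -/
theorem twistExtensionFun_injective : Injective (c.twistExtensionFun e d) :=
  LeftInverse.injective (c.twistExtensionInv_twistExtensionFun e d)

/-- The inverse extension is injective. [folklore] -/
theorem twistExtensionInv_injective : Injective (c.twistExtensionInv e d) :=
  LeftInverse.injective (c.twistExtensionFun_twistExtensionInv e d)

variable {d}

/-- Off the part `c(∂M × [0, 1/2])` of the collar the extension is the identity
(`0 < d ≤ 1/3`). [folklore] -/
theorem twistExtensionFun_eq_self (hd : 0 < d) (hd' : d ≤ 1 / 3) {p : M}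
    (hp : p ∉ c '' {q | (q.2 : ℝ) ≤ 1 / 2}) : c.twistExtensionFun e d p = p := by
  by_cases hp' : p ∈ range c
  · obtain ⟨q, rfl⟩ := hp'
    rw [twistExtensionFun_apply, e.slabSlide_eq_self hd]
    by_contra hlt
    exact hp ⟨q, show (q.2 : ℝ) ≤ 1 / 2 by push Not at hlt; linarith, rfl⟩
  · exact twistExtensionFun_of_not_mem _ _ _ hp'

/-- Off the part `c(∂M × [0, 1/2])` of the collar the inverse extension is the identity
(`0 < d ≤ 1/3`). [folklore] -/
theorem twistExtensionInv_eq_self (hd : 0 < d) (hd' : d ≤ 1 / 3) {p : M}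
    (hp : p ∉ c '' {q | (q.2 : ℝ) ≤ 1 / 2}) : c.twistExtensionInv e d p = p := by
  by_cases hp' : p ∈ range c
  · obtain ⟨q, rfl⟩ := hp'
    rw [twistExtensionInv_apply, e.slabUnslide_eq_self hd]
    by_contra hlt
    exact hp ⟨q, show (q.2 : ℝ) ≤ 1 / 2 by push Not at hlt; linarith, rfl⟩
  · exact twistExtensionInv_of_not_mem _ _ _ hp'

/-- A collar point above height `3d/2` is fixed by the extension. [folklore] -/
theorem twistExtensionFun_apply_of_le (hd : 0 < d) {q : b.carrier × Set.Icc (0 : ℝ) 1}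
    (hq : 3 * d / 2 ≤ (q.2 : ℝ)) : c.twistExtensionFun e d (c q) = c q := by
  rw [twistExtensionFun_apply, e.slabSlide_eq_self hd hq]

/-- A collar point above height `3d/2` is fixed by the inverse extension. [folklore] -/
theorem twistExtensionInv_apply_of_le (hd : 0 < d) {q : b.carrier × Set.Icc (0 : ℝ) 1}
    (hq : 3 * d / 2 ≤ (q.2 : ℝ)) : c.twistExtensionInv e d (c q) = c q := by
  rw [twistExtensionInv_apply, e.slabUnslide_eq_self hd hq]

variable (d)

/-- A collar point off the supporting annulus slab is fixed by the extension. [folklore] -/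
theorem twistExtensionFun_apply_of_not_mem_support {q : b.carrier × Set.Icc (0 : ℝ) 1}
    (hq : q.1 ∉ e.support) : c.twistExtensionFun e d (c q) = c q := by
  rw [twistExtensionFun_apply]
  congr 1
  ext1
  · exact e.twistAt_of_not_mem_support _ hq
  · rfl

/-- A collar point off the supporting annulus slab is fixed by the inverse extension. [folklore] -/
theorem twistExtensionInv_apply_of_not_mem_support {q : b.carrier × Set.Icc (0 : ℝ) 1}
    (hq : q.1 ∉ e.support) : c.twistExtensionInv e d (c q) = c q := by
  rw [twistExtensionInv_apply]
  congr 1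
  ext1
  · exact e.untwistAt_of_not_mem_support _ hq
  · rfl

/-- **On the boundary the extension is the depth-`0` twist** (the inverse Dehn twist). [folklore] -/
theorem twistExtensionFun_incl (x : b.carrier) :
    c.twistExtensionFun e d (b.incl x) = b.incl (e.twistAt 0 x) := by
  rw [← c.apply_bot, twistExtensionFun_apply, e.slabSlide_bot, c.apply_bot]

/-- **On the boundary the inverse extension is the depth-`0` inverse twist** (the Dehn twist). [folklore] -/
theorem twistExtensionInv_incl (x : b.carrier) :
    c.twistExtensionInv e d (b.incl x) = b.incl (e.untwistAt 0 x) := by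
  rw [← c.apply_bot, twistExtensionInv_apply, e.slabUnslide_bot, c.apply_bot]

/-- The **core circle** `c (e (𝕊 1 × {1/2}) × {d})` of the extension in `M` (the height is
clamped to `[0, 1]`; in every use `0 < d ≤ 1/3`). [folklore] -/
def twistCore : Set M := range fun u : 𝕊 1 ↦ c (e (u, 1 / 2), Set.projIcc 0 1 zero_le_one d)

variable {d}

/-- The core circle is the image of the core of the cylinder slide (`0 < d ≤ 1`). [folklore] -/
theorem twistCore_eq_image (hd : 0 < d) (hd1 : d ≤ 1) : c.twistCore e d = c '' e.slabCore d := by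
  apply Subset.antisymm
  · rintro _ ⟨u, rfl⟩
    refine ⟨(e (u, 1 / 2), Set.projIcc 0 1 zero_le_one d), ?_, rfl⟩
    rw [e.mk_apply_mem_slabCore_iff hd, coe_projIcc_unit_of_mem hd.le hd1]
    exact ⟨rfl, rfl⟩
  · rintro _ ⟨⟨x, s⟩, hq, rfl⟩
    obtain ⟨⟨u, r⟩, hx⟩ : x ∈ range e := e.fst_mem_range_of_mem_slabCore hq
    subst hx
    obtain ⟨hr, hs⟩ := (e.mk_apply_mem_slabCore_iff hd (u, r) s).1 hq
    simp only at hr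
    subst hr
    have hs' : Set.projIcc (0 : ℝ) 1 zero_le_one d = s :=
      Subtype.ext (by rw [coe_projIcc_unit_of_mem hd.le hd1, hs])
    exact ⟨u, by simp only [hs']⟩

/-- A collar point lies on the core circle iff it lies in the core of the slide. [folklore] -/
theorem apply_mem_twistCore_iff (hd : 0 < d) (hd1 : d ≤ 1) (q : b.carrier × Set.Icc (0 : ℝ) 1) :
    c q ∈ c.twistCore e d ↔ q ∈ e.slabCore d := by
  rw [c.twistCore_eq_image e hd hd1, c.injective.mem_set_image]

/-- The extension maps the core circle into itself. [folklore] -/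
theorem twistExtensionFun_mem_twistCore (hd : 0 < d) (hd1 : d ≤ 1) {p : M}
    (hp : p ∈ c.twistCore e d) : c.twistExtensionFun e d p ∈ c.twistCore e d := by
  obtain ⟨u, rfl⟩ := hp
  rw [twistExtensionFun_apply, e.slabSlide_apply_core hd hd1]
  exact ⟨circleMul (twistProfile punct) u, rfl⟩

/-- The inverse extension maps the core circle into itself. [folklore] -/
theorem twistExtensionInv_mem_twistCore (hd : 0 < d) (hd1 : d ≤ 1) {p : M}
    (hp : p ∈ c.twistCore e d) : c.twistExtensionInv e d p ∈ c.twistCore e d := by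
  obtain ⟨u, rfl⟩ := hp
  rw [twistExtensionInv_apply, e.slabUnslide_apply_core hd hd1]
  exact ⟨circleMul (conjCircle (twistProfile punct)) u, rfl⟩

/-- The extension maps the complement of the core circle into itself. [folklore] -/
theorem twistExtensionFun_not_mem_twistCore (hd : 0 < d) (hd1 : d ≤ 1) {p : M}
    (hp : p ∉ c.twistCore e d) : c.twistExtensionFun e d p ∉ c.twistCore e d := by
  intro h
  apply hp
  have := c.twistExtensionInv_mem_twistCore e hd hd1 h
  rwa [twistExtensionInv_twistExtensionFun] at this

/-- The inverse extension maps the complement of the core circle into itself. [folklore] -/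
theorem twistExtensionInv_not_mem_twistCore (hd : 0 < d) (hd1 : d ≤ 1) {p : M}
    (hp : p ∉ c.twistCore e d) : c.twistExtensionInv e d p ∉ c.twistCore e d := by
  intro h
  apply hp
  have := c.twistExtensionFun_mem_twistCore e hd hd1 h
  rwa [twistExtensionFun_twistExtensionInv] at this

/-- The core circle is compact. [folklore] -/
theorem isCompact_twistCore : IsCompact (c.twistCore e d) :=
  isCompact_range (by have := c.continuous; have := e.continuous; fun_prop)

/-- The core circle is closed (`M` Hausdorff). [folklore] -/
theorem isClosed_twistCore [T2Space M] : IsClosed (c.twistCore e d) := (c.isCompact_twistCore e).isClosed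

/-- Away from the bottom, the core circle lies in the interior of `M` (`0 < d ≤ 1`). [folklore] -/
theorem twistCore_subset_interior (hd : 0 < d) (hd1 : d ≤ 1) : c.twistCore e d ⊆ I.interior M := by
  rintro _ ⟨u, rfl⟩
  apply c.apply_mem_interior
  show (⊥ : Set.Icc (0 : ℝ) 1) < Set.projIcc 0 1 zero_le_one d
  rw [← Subtype.coe_lt_coe, coe_projIcc_unit_of_mem hd.le hd1]
  exact hd

/-- The core circle misses the boundary (`0 < d ≤ 1`). [folklore] -/
theorem incl_not_mem_twistCore (hd : 0 < d) (hd1 : d ≤ 1) (x : b.carrier) :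
    b.incl x ∉ c.twistCore e d := by
  intro h
  have h1 := c.twistCore_subset_interior e hd hd1 h
  have h2 := b.incl_mem_boundary x
  rw [← ModelWithCorners.compl_interior] at h2
  exact h2 h1

variable [CompactSpace b.carrier] [T2Space M]

variable [T2Space b.carrier] [IsManifold I ∞ M]

/-- **The extension is smooth off the core circle** (`0 < d ≤ 1/3`): on the collar by descent of
smoothness along the collar (`contMDiffAt_of_comp_isImmersionAt_of_nhds`), off
`c(∂M × [0, 1/2])` it is locally the identity. [folklore] -/
theorem contMDiffOn_twistExtensionFun (hd : 0 < d) (hd' : d ≤ 1 / 3) :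
    ContMDiffOn I I ∞ (c.twistExtensionFun e d) (c.twistCore e d)ᶜ := by
  intro p hpK
  apply ContMDiffAt.contMDiffWithinAt
  by_cases hp : p ∈ c '' {q : b.carrier × Set.Icc (0 : ℝ) 1 | (q.2 : ℝ) ≤ 1 / 2}
  · obtain ⟨q, hq, rfl⟩ := hp
    have hq1 : (q.2 : ℝ) < 1 := lt_of_le_of_lt hq (by norm_num)
    have hqK : q ∉ e.slabCore d := fun h ↦ hpK ((c.apply_mem_twistCore_iff e hd (by linarith) q).2 h)
    have hslide : ContMDiffAt (I₀.prod (𝓡∂ 1)) (I₀.prod (𝓡∂ 1)) ∞ (e.slabSlide d) q :=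
      (e.contMDiffOn_slabSlide d).contMDiffAt ((e.isClosed_slabCore d).isOpen_compl.mem_nhds hqK)
    exact contMDiffAt_of_comp_isImmersionAt_of_nhds
      (c.isSmoothEmbedding.isImmersion.isImmersionAt q) (fun U hU ↦ c.image_mem_nhds hq1 hU)
      (c.isSmoothEmbedding.contMDiff.contMDiffAt.comp q hslide)
      (fun q' ↦ c.twistExtensionFun_apply e d q')
  · have hev : c.twistExtensionFun e d =ᶠ[𝓝 p] id :=
      Filter.eventuallyEq_of_mem ((c.isClosed_image_lowerHalf).isOpen_compl.mem_nhds hp)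
        fun p' hp' ↦ c.twistExtensionFun_eq_self e hd hd' hp'
    exact contMDiffAt_id.congr_of_eventuallyEq hev

/-- **The inverse extension is smooth off the core circle** (`0 < d ≤ 1/3`). [folklore] -/
theorem contMDiffOn_twistExtensionInv (hd : 0 < d) (hd' : d ≤ 1 / 3) :
    ContMDiffOn I I ∞ (c.twistExtensionInv e d) (c.twistCore e d)ᶜ := by
  intro p hpK
  apply ContMDiffAt.contMDiffWithinAt
  by_cases hp : p ∈ c '' {q : b.carrier × Set.Icc (0 : ℝ) 1 | (q.2 : ℝ) ≤ 1 / 2}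
  · obtain ⟨q, hq, rfl⟩ := hp
    have hq1 : (q.2 : ℝ) < 1 := lt_of_le_of_lt hq (by norm_num)
    have hqK : q ∉ e.slabCore d := fun h ↦ hpK ((c.apply_mem_twistCore_iff e hd (by linarith) q).2 h)
    have hslide : ContMDiffAt (I₀.prod (𝓡∂ 1)) (I₀.prod (𝓡∂ 1)) ∞ (e.slabUnslide d) q :=
      (e.contMDiffOn_slabUnslide d).contMDiffAt ((e.isClosed_slabCore d).isOpen_compl.mem_nhds hqK)
    exact contMDiffAt_of_comp_isImmersionAt_of_nhds
      (c.isSmoothEmbedding.isImmersion.isImmersionAt q) (fun U hU ↦ c.image_mem_nhds hq1 hU)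
      (c.isSmoothEmbedding.contMDiff.contMDiffAt.comp q hslide)
      (fun q' ↦ c.twistExtensionInv_apply e d q')
  · have hev : c.twistExtensionInv e d =ᶠ[𝓝 p] id :=
      Filter.eventuallyEq_of_mem ((c.isClosed_image_lowerHalf).isOpen_compl.mem_nhds hp)
        fun p' hp' ↦ c.twistExtensionInv_eq_self e hd hd' hp'
    exact contMDiffAt_id.congr_of_eventuallyEq hev

/-- **Lickorish's twist spread over the collar, as a partial diffeomorphism of `M` off the core
circle**: an open partial homeomorphism with source and target the complement of the core circle,
`C^∞` with `C^∞` inverse there (`contMDiffOn_twistExtensionFun`, `contMDiffOn_twistExtensionInv`).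
[cite: LickorishAnnals1962, proof of Thm. 2 (p. 539, Fig. 11)] -/
def twistExtension (hd : 0 < d) (hd' : d ≤ 1 / 3) : OpenPartialHomeomorph M M where
  toFun := c.twistExtensionFun e d
  invFun := c.twistExtensionInv e d
  source := (c.twistCore e d)ᶜ
  target := (c.twistCore e d)ᶜ
  map_source' _ hp := c.twistExtensionFun_not_mem_twistCore e hd (by linarith) hp
  map_target' _ hp := c.twistExtensionInv_not_mem_twistCore e hd (by linarith) hp
  left_inv' p _ := c.twistExtensionInv_twistExtensionFun e d p
  right_inv' p _ := c.twistExtensionFun_twistExtensionInv e d p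
  open_source := (c.isClosed_twistCore e).isOpen_compl
  open_target := (c.isClosed_twistCore e).isOpen_compl
  continuousOn_toFun := (c.contMDiffOn_twistExtensionFun e hd hd').continuousOn
  continuousOn_invFun := (c.contMDiffOn_twistExtensionInv e hd hd').continuousOn

/-- The partial homeomorphism `twistExtension` is `twistExtensionFun` as a function. [folklore] -/
@[simp] theorem twistExtension_apply (hd : 0 < d) (hd' : d ≤ 1 / 3) (p : M) :
    c.twistExtension e hd hd' p = c.twistExtensionFun e d p := rfl

/-- The inverse of `twistExtension` is `twistExtensionInv` as a function. [folklore] -/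
@[simp] theorem twistExtension_symm_apply (hd : 0 < d) (hd' : d ≤ 1 / 3) (p : M) :
    (c.twistExtension e hd hd').symm p = c.twistExtensionInv e d p := rfl

/-- The source of `twistExtension` is the complement of the core circle. [folklore] -/
theorem twistExtension_source (hd : 0 < d) (hd' : d ≤ 1 / 3) :
    (c.twistExtension e hd hd').source = (c.twistCore e d)ᶜ := rfl

/-- The target of `twistExtension` is the complement of the core circle. [folklore] -/
theorem twistExtension_target (hd : 0 < d) (hd' : d ≤ 1 / 3) :
    (c.twistExtension e hd hd').target = (c.twistCore e d)ᶜ := rfl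

/-- `twistExtension` is `C^∞` on its source (the complement of the core circle). [folklore] -/
theorem contMDiffOn_twistExtension (hd : 0 < d) (hd' : d ≤ 1 / 3) :
    ContMDiffOn I I ∞ (c.twistExtension e hd hd') (c.twistExtension e hd hd').source :=
  c.contMDiffOn_twistExtensionFun e hd hd'

/-- The inverse of `twistExtension` is `C^∞` on its source (the complement of the core circle). [folklore] -/
theorem contMDiffOn_twistExtension_symm (hd : 0 < d) (hd' : d ≤ 1 / 3) :
    ContMDiffOn I I ∞ (c.twistExtension e hd hd').symm (c.twistExtension e hd hd').target :=
  c.contMDiffOn_twistExtensionInv e hd hd'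

end BoundaryData.Collar

end Extension

end Literature.Topology.FourManifolds
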